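import Summits.ResolutionOfSingularities.ResolutionOfSingularities.Theorems.WeightedInvariantLocalWeightedDropWildPurePowerFlagBasic
import Summits.ResolutionOfSingularities.ResolutionOfSingularities.Theorems.WeightedInvariantLocalWeightedDropWildPurePowerFlagStatements
import Summits.ResolutionOfSingularities.ResolutionOfSingularities.Theorems.WeightedInvariantLocalWeightedDropWildPurePowerFlagStepZero
import Literature.AlgebraicGeometry.Resolution.PointBlowupFlagDropExceptionalY

/-!
# `WeightedInvariant.LocalWeightedDrop`, line `hasse-ridge-face-selection`, piece S3πM: the TRANSLATED successor
# `x^q·T = B(x, x(t+y))` on the game-side flag invariant, and [HP24, Prop. 4] CASE (ii) as a clause of `DropStatement`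

Crux item stmt-ResolutionOfSingularities-8899 `LocalWeightedDrop` (route `ResolutionOfSingularities/WeightedInvariant`), serving the
door `WeightedConstruction` stmt-ResolutionOfSingularities-0571.  [OURS · L1 W4.3, chain w43, stub worker 2 (gen 3); game-side
counterpart of the atlas-model files `Literature/…/PointBlowupFlagTranslatedStep`, `…/PointBlowupFlagLostComponents` (p505057,
p505743) of the same seat.  Not a statement of any manuscript.  The printed source is H. Hauser, S. Perlega, *Resolving surface
singularities in positive characteristic*, Publ. RIMS **60** (2024), §4 pp. 779–780 (`F′_t(x,y) = x^{−pᵉ} F_t(x, xy)`, Figure 1: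
`d′_res ≤ d_t`) and the proof of Prop. 4, case (ii) p. 795 (`n_𝓖 = 0`, `t ≠ 0`, `E_a = V(xy)`: `d_𝓖 = d′_res ≤ d^curv_𝓕 = d_𝓕`, or
else `X′` is in the small residual / monomial case at `a′`).]

On res-L1-w43-stub-1's definitions (`PurePowerFlag.*`, p504698/p506378/p506561) and res-D-pv-058's series step API (p506748
`…FlagStepZero`, Literature `PointBlowupFlagDropMonomialStep` / `TangentStep` / `StepTyped` / `DropExceptionalY`):

* `X_pow_mul_clean_eq_stepZero_expansion` — THE TRANSLATED SUCCESSOR IS THE AXIS SUCCESSOR OF THE SHEARED EXPANSION: from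
  `x^q·T = subst (dirChart t) B` we get `x^q·(cleanSeries q T) = subst (dirChart 0) B₀` with `B₀ = expansion q B (C t * X)`
  (`= cleanSeries q (B(x, y + t x))`, the expansion along the parent flag `y + t x` in stub-1's sign convention), so every
  `…_stepZero` lemma of `…FlagStepZero` applies to the pair `(B₀, cleanSeries q T)`.
* `order_divMonomial_single_zero`, `termSub_of_dRes_lt` — the small residual reading at `a′`;
  `dRes_singleton_zero_le_of_stepZero` — FIGURE 1 on series: `dRes C {0} ≤ j` for every least-degree monomial `x^{o−j} y^j` of
  `B₀`.
* `exists_gt_of_isN0_stepT` — **[HP24, Prop. 4] CASE (ii) AS A `DropStatement` CLAUSE**: for `t ≠ 0` and both letters exceptional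
  at the parent, EVERY `n = 0` flag `g` of the cleaned successor `C` with boundary `succE t E = {0}` has
  `flagTriple q C (succE t E) g < flagTriple q B E (C t * X)`, an admissible (tangent, `n = 1`) flag triple of `(B, E)`,
  provided `C` is not terminal up to a triangular change.  (For `t ≠ 0` with `y` NOT exceptional the parent flag `C t * X` is
  an `n = 0` flag and the comparison of the `s`-components belongs to case (i) after the shear — not in this file.)
-/

set_option linter.dupNamespace false -- mandated namespace of this single-conjunct summit

namespace Summit.ResolutionOfSingularities.ResolutionOfSingularities.Theorems

open Literature.AlgebraicGeometry.Resolution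
open Literature.AlgebraicGeometry.Resolution.HauserPerlega2024

namespace PurePowerFlag

open MvPowerSeries

variable {k : Type} [Field k]

/-! ### The translated successor is the axis successor of the sheared expansion -/

/-- The shift by `t·x` of `PointBlowupFlagStepTyped` is stub-1's `shift (C t * X)`. -/
theorem shift_C_mul_X_eq (t : k) :
    shift (PowerSeries.C t * PowerSeries.X) = fun l : Fin 2 => if l = (1 : Fin 2) then
        (X 1 : MvPowerSeries (Fin 2) k) + PowerSeries.subst (X 0 : MvPowerSeries (Fin 2) k) (PowerSeries.C t * PowerSeries.X)
      else X l := rfl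

/-- **`x^q · C = B₀(x, x(0 + y))`**: the cleaned translated successor `C = cleanSeries q T` of `x^q·T = B(x, x(t+y))` is the axis
successor of the expansion `B₀ = expansion q B (C t * X)` of `B` along the parent flag `y + t·x` — "`F′_t(x,y) = x^{−pᵉ} F_t(x, xy)`
and `F_t(x,y)` are related to each other by a monomial substitution of the parameters" [HP24 §4 p. 779]. -/
theorem X_pow_mul_clean_eq_stepZero_expansion (q : ℕ) {B T : MvPowerSeries (Fin 2) k} (t : k)
    (hT : (X 0 : MvPowerSeries (Fin 2) k) ^ q * T = subst (PlaneGerm.dirChart t) B) :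
    (X 0 : MvPowerSeries (Fin 2) k) ^ q * cleanSeries q T =
      subst (PlaneGerm.dirChart (0 : k)) (expansion q B (PowerSeries.C t * PowerSeries.X)) := by
  rw [← cleanSeries_X_pow_mul, hT, subst_dirChart_eq_step_shift, cleanSeries_subst_step q 0 1 zero_ne_one_fin fin_two_cases,
    subst_dirChart_zero_eq]
  rfl

/-- The expansion along any flag of a position of order `> q` has order `> q` (a substitution without constant terms and a deletion
of monomials do not lower the order). -/
theorem lt_order_expansion (q : ℕ) {B : MvPowerSeries (Fin 2) k} (hq : ((q : ℕ) : ℕ∞) < B.order) (h : PowerSeries k)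
    (h0 : PowerSeries.constantCoeff h = 0) : ((q : ℕ) : ℕ∞) < (expansion q B h).order := by
  unfold expansion
  refine lt_of_lt_of_le hq (le_trans (order_le_order_subst (shift h) (constantCoeff_shift h h0) B)
    (order_le_order_cleanSeries q _))

/-- If the cleaned translated successor is non-zero then so is the sheared expansion `B₀`. -/
theorem expansion_ne_zero_of_clean_ne_zero (q : ℕ) {B T : MvPowerSeries (Fin 2) k} (t : k)
    (hT : (X 0 : MvPowerSeries (Fin 2) k) ^ q * T = subst (PlaneGerm.dirChart t) B) (hC : cleanSeries q T ≠ 0) :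
    expansion q B (PowerSeries.C t * PowerSeries.X) ≠ 0 := by
  intro h0
  have h := X_pow_mul_clean_eq_stepZero_expansion q t hT
  rw [h0] at h
  apply hC
  have ha : HasSubst (PlaneGerm.dirChart (0 : k) : Fin 2 → MvPowerSeries (Fin 2) k) := by
    rw [← step_eq_dirChart_zero]; exact hasSubst_step 0 1
  apply X_pow_mul_left_cancel (0 : Fin 2) q
  rw [h, mul_zero, ← MvPowerSeries.coe_substAlgHom ha, map_zero]

/-! ### The small residual reading at `a′` -/

/-- The coefficients of the quotient by `x^r`. -/
theorem coeff_divMonomial_single (r : ℕ) (C : MvPowerSeries (Fin 2) k) (d : Fin 2 →₀ ℕ) :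
    coeff d (divMonomial (Finsupp.single (0 : Fin 2) r) C) = coeff (d + Finsupp.single (0 : Fin 2) r) C := rfl

/-- **`ord (C / x^r) = ord C − r`** when `x^r` divides every monomial of the non-zero series `C`. -/
theorem order_divMonomial_single_zero {C : MvPowerSeries (Fin 2) k} (hC : C ≠ 0) {r : ℕ}
    (hr : ∀ m, coeff m C ≠ 0 → r ≤ m 0) :
    (divMonomial (Finsupp.single (0 : Fin 2) r) C).order = ((C.order.toNat - r : ℕ) : ℕ∞) := by
  classical
  obtain ⟨d₀, hd₀, hd₀deg⟩ := exists_coeff_ne_zero_degree_eq_order hC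
  have hr₀ := hr d₀ hd₀
  apply le_antisymm
  · have hcoef : coeff (d₀ - Finsupp.single (0 : Fin 2) r) (divMonomial (Finsupp.single (0 : Fin 2) r) C) ≠ 0 := by
      rw [coeff_divMonomial_single, tsub_add_cancel_of_le (Finsupp.single_le_iff.mpr hr₀)]
      exact hd₀
    refine (MvPowerSeries.order_le hcoef).trans (le_of_eq ?_)
    have hdeg : (d₀ - Finsupp.single (0 : Fin 2) r).degree = d₀.degree - r := by
      rw [Finsupp.degree_eq_sum, Finsupp.degree_eq_sum, Fin.sum_univ_two, Fin.sum_univ_two, Finsupp.tsub_apply,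
        Finsupp.tsub_apply, Finsupp.single_eq_same, Finsupp.single_eq_of_ne (by decide : (1 : Fin 2) ≠ 0)]
      omega
    rw [hdeg, Finsupp.degree_eq_sum, Fin.sum_univ_two, hd₀deg]
  · refine MvPowerSeries.le_order fun d hd => ?_
    rw [coeff_divMonomial_single]
    by_contra hne
    have h1 := order_toNat_le_degree hne
    rw [Finsupp.add_apply, Finsupp.add_apply, Finsupp.single_eq_same,
      Finsupp.single_eq_of_ne (by decide : (1 : Fin 2) ≠ 0), add_zero] at h1
    have h2 : d.degree < C.order.toNat - r := by exact_mod_cast hd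
    rw [Finsupp.degree_eq_sum, Fin.sum_univ_two] at h2
    omega

/-- **The small residual case at `a′`** ([HP24, Prop. 4 (ii)] p. 795: "`F′ = x^{(k−1)pᵉ}·G′`, where `ord G′ = d′_res < pᵉ` … `ord G′ > 0`
… the small residual case"): a clean non-zero `C` with `ord_x C = q·m`, `m ≥ 1`, and `0 < d_res({x}) < q` is terminal up to the
trivial triangular change. -/
theorem termSub_of_dRes_lt {q : ℕ} {C : MvPowerSeries (Fin 2) k} (hC : C ≠ 0) (hclean : cleanSeries q C = C) {m : ℕ}
    (hm : 0 < m) (hordx : ordAlong (0 : Fin 2) C = ((q * m : ℕ) : ℕ∞)) (hpos : 0 < dRes C {0}) (hlt : dRes C {0} < q) :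
    TermSub q C := by
  have hr : ∀ d, coeff d C ≠ 0 → q * m ≤ d 0 := fun d hd => by
    have := ordAlong_le (0 : Fin 2) hd; rw [hordx] at this; exact_mod_cast this
  have hdres : dRes C {0} = C.order.toNat - q * m := by
    unfold dRes; rw [Finset.sum_singleton, hordx, ENat.toNat_coe]
  refine ⟨false, 0, map_zero _, Or.inr ⟨0, m, divMonomial (Finsupp.single (0 : Fin 2) (q * m)) C, hm, ?_, ?_, ?_⟩⟩
  · rw [order_divMonomial_single_zero hC hr, ← hdres]; exact_mod_cast hpos
  · rw [order_divMonomial_single_zero hC hr, ← hdres]; exact_mod_cast hlt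
  · rw [orient_false, expansion_zero, hclean, X_pow_eq]
    exact (monomial_mul_divMonomial _ C fun d hd => Finsupp.single_le_iff.mpr (hr d hd)).symm

/-! ### FIGURE 1 on series: `d′_res ≤ d_t` -/

/-- **FIGURE 1** ([HP24 §4 p. 780]: "We see that the inequality `d′_res ≤ d_t` holds"): along the axis successor `x^q·C = B₀(x, xy)`
of a series `B₀` of order `o ≥ q`, for every least-degree monomial `x^{o−j} y^j` of `B₀` the residual order of `C` with respect to the
new exceptional letter `x` is at most `j` (the monomial is carried to `x^{o−q} y^j`, of degree `(o − q) + j`, while `ord_x C = o − q`). -/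
theorem dRes_singleton_zero_le_of_stepZero (q : ℕ) {B₀ C : MvPowerSeries (Fin 2) k} (hB₀ : B₀ ≠ 0)
    (hq : ((q : ℕ) : ℕ∞) ≤ B₀.order)
    (hC : (X 0 : MvPowerSeries (Fin 2) k) ^ q * C = subst (PlaneGerm.dirChart (0 : k)) B₀)
    {d₀ : Fin 2 →₀ ℕ} (hd₀ : coeff d₀ B₀ ≠ 0) (hd₀deg : d₀ 0 + d₀ 1 = B₀.order.toNat) : dRes C {0} ≤ d₀ 1 := by
  have hordx := ordAlong_zero_stepZero q hB₀ hq hC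
  have hC' := hC
  rw [subst_dirChart_zero_eq] at hC'
  obtain ⟨hqd, hcoef⟩ := coeff_eq_of_step' q 0 1 zero_ne_one_fin fin_two_cases B₀ C hC' d₀ hd₀
  have hne : coeff (Finsupp.single 0 (d₀ 0 + d₀ 1 - q) + Finsupp.single 1 (d₀ 1)) C ≠ 0 := by rw [hcoef]; exact hd₀
  have h1 := order_toNat_le_degree hne
  rw [Finsupp.add_apply, Finsupp.add_apply, Finsupp.single_eq_same, Finsupp.single_eq_same,
    Finsupp.single_eq_of_ne (by decide : (0 : Fin 2) ≠ 1), Finsupp.single_eq_of_ne (by decide : (1 : Fin 2) ≠ 0),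
    add_zero, zero_add] at h1
  unfold dRes
  rw [Finset.sum_singleton, hordx, ENat.toNat_coe]
  omega

/-! ### [HP24, Prop. 4], case (ii) as a clause of `DropStatement` -/

/-- The parent flag `y + t·x` (`t ≠ 0`) is a TANGENT flag with `n = 1` when both letters are exceptional
("Since `E_a = V(xy)`, we know that `n_𝓕 = 1`" [HP24 p. 795]). -/
theorem isTangent_C_mul_X {E : Finset (Fin 2)} (h0 : (0 : Fin 2) ∈ E) (h1 : (1 : Fin 2) ∈ E) {t : k} (ht : t ≠ 0) :
    IsTangent E (PowerSeries.C t * PowerSeries.X) := by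
  refine ⟨h1, ?_, Or.inr h0⟩
  intro h
  have := congrArg (PowerSeries.coeff 1) h
  rw [PowerSeries.coeff_C_mul, PowerSeries.coeff_one_X, mul_one, map_zero] at this
  exact ht this

/-- `tangency (C t * X) = 1` for `t ≠ 0`. -/
theorem tangency_C_mul_X {t : k} (ht : t ≠ 0) : tangency (PowerSeries.C t * PowerSeries.X) = 1 := by
  unfold tangency
  have h : (PowerSeries.C t * PowerSeries.X).order = ((1 : ℕ) : ℕ∞) := by
    rw [PowerSeries.order_eq_nat]
    refine ⟨by rw [PowerSeries.coeff_C_mul, PowerSeries.coeff_one_X, mul_one]; exact ht, fun i hi => ?_⟩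
    obtain rfl : i = 0 := by omega
    rw [PowerSeries.coeff_C_mul, PowerSeries.coeff_zero_X, mul_zero]
  rw [h, ENat.toNat_coe]

/-- The weights of a flag with `n = 1` are all `1`, so `ord_ω` is the order and `in_ω` the initial form. -/
theorem weights_one_eq : weights 1 = fun _ : Fin 2 => 1 := by
  funext i; unfold weights; split_ifs <;> rfl

/-- **[HP24, Prop. 4] CASE (ii) as a clause of `DropStatement`** (`n_𝓖 = 0`, `t ≠ 0`, `E_a = V(xy)`): along the translated
successor `x^q·T = B(x, x(t+y))`, `t ≠ 0`, of a position `B` (`ord B > q`) with BOTH letters exceptional, if the cleaned successor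
`C = cleanSeries q T` is not terminal up to a triangular change, then every `n = 0` flag `g` of `(C, succE t E)` has a flag triple
strictly below the triple of the tangent parent flag `y + t·x` (`n_𝓕 = 1`): `(d′_res, 0, s_𝓖) < (d_𝓕, 1, 0)` because
`d′_res ≤ d_t = d^curv_𝓕` (Figure 1) and the clause `d_𝓕 = 0` (`0 < d_t < q`, `q ∣ ord F_t`) would make `C` terminal (small residual
or monomial case). [HP24 Prop. 4 proof, case (ii), p. 795] -/
theorem exists_gt_of_isN0_stepT (q : ℕ) {B T : MvPowerSeries (Fin 2) k} (hq : ((q : ℕ) : ℕ∞) < B.order) {t : k}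
    (ht : t ≠ 0) (hT : (X 0 : MvPowerSeries (Fin 2) k) ^ q * T = subst (PlaneGerm.dirChart t) B) {E : Finset (Fin 2)}
    (h0E : (0 : Fin 2) ∈ E) (h1E : (1 : Fin 2) ∈ E) (hnt : ¬ TermSub q (cleanSeries q T)) (g : PowerSeries k)
    (hN0 : IsN0 (succE t E) g) :
    ∃ v : Triple, IsFlagTriple q B E v ∧ flagTriple q (cleanSeries q T) (succE t E) g < v := by
  classical
  set C := cleanSeries q T with hCdef
  set hpar : PowerSeries k := PowerSeries.C t * PowerSeries.X with hpar_def
  set B₀ := expansion q B hpar with hB₀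
  have hE' : succE t E = {0} := by unfold succE; rw [if_neg (fun h => ht h.1)]
  have hpar0 : PowerSeries.constantCoeff hpar = 0 := by
    rw [hpar_def, map_mul, PowerSeries.constantCoeff_X, mul_zero]
  have hTan : IsTangent E hpar := isTangent_C_mul_X h0E h1E ht
  refine ⟨flagTriple q B E hpar, ⟨false, hpar, hpar0, Or.inr hTan, by rw [orient_false, orientE_false]⟩, ?_⟩
  rw [flagTriple_of_isN0 q C hN0, flagTriple_of_not_isN0 q B hTan.not_isN0, tangency_C_mul_X ht, hE']
  -- the step relation for `(B₀, C)`
  have hstep : (X 0 : MvPowerSeries (Fin 2) k) ^ q * C = subst (PlaneGerm.dirChart (0 : k)) B₀ :=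
    X_pow_mul_clean_eq_stepZero_expansion q t hT
  have hqB₀ : ((q : ℕ) : ℕ∞) < B₀.order := lt_order_expansion q hq hpar hpar0
  have hCclean : cleanSeries q C = C := cleanSeries_cleanSeries q T
  -- degenerate successor
  by_cases hC0 : C = 0
  · have hd0 : dRes C {0} = 0 := by unfold dRes; rw [hC0, MvPowerSeries.order_zero, ENat.toNat_top, Nat.zero_sub]
    rw [hd0, Prod.Lex.toLex_lt_toLex]
    rcases Nat.eq_zero_or_pos (dFlag q B hpar 1) with h | h
    · right; exact ⟨h.symm, Prod.Lex.toLex_lt_toLex.mpr (Or.inl zero_lt_one)⟩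
    · left; exact h
  have hB₀ne : B₀ ≠ 0 := expansion_ne_zero_of_clean_ne_zero q t hT hC0
  -- `d_t`, attained at a least-degree monomial `d₀` of `B₀`
  have hin0 : initialPart (weights 1) B₀ ≠ 0 := by
    obtain ⟨d₁, hd₁, hd₁deg⟩ := exists_coeff_ne_zero_degree_eq_order hB₀ne
    intro h0
    have : coeff d₁ (initialPart (weights 1) B₀) ≠ 0 := by
      rw [coeff_initialPart_ne_zero_iff]
      refine ⟨hd₁, ?_⟩
      rw [weights_one_eq, wOrder_eq, ← Finsupp.degree_eq_weight_one]
      change ((d₁.degree : ℕ) : ℕ∞) = B₀.order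
      rw [Finsupp.degree_eq_sum, Fin.sum_univ_two, hd₁deg]
      exact (MvPowerSeries.ne_zero_iff_order_finite.mp hB₀ne)
    rw [h0, map_zero] at this
    exact this rfl
  obtain ⟨d₀, hd₀in, hd₀y⟩ := exists_coeff_ne_zero_ordAlong (1 : Fin 2) hin0
  obtain ⟨hd₀, hd₀w⟩ := (coeff_initialPart_ne_zero_iff _ _ _).mp hd₀in
  have hd₀deg : d₀ 0 + d₀ 1 = B₀.order.toNat := by
    rw [weights_one_eq, wOrder_eq, ← Finsupp.degree_eq_weight_one] at hd₀w
    change ((d₀.degree : ℕ) : ℕ∞) = B₀.order at hd₀w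
    rw [← (MvPowerSeries.ne_zero_iff_order_finite.mp hB₀ne)] at hd₀w
    have h3 : d₀.degree = B₀.order.toNat := by exact_mod_cast hd₀w
    rw [Finsupp.degree_eq_sum, Fin.sum_univ_two] at h3
    exact h3
  have hdcurv : dcurv q B hpar 1 = ((d₀ 1 : ℕ) : ℕ∞) := by
    show ordAlong (1 : Fin 2) (initialPart (weights 1) B₀) = _
    rw [hd₀y]
  -- Figure 1
  have hres : dRes C {0} ≤ d₀ 1 := dRes_singleton_zero_le_of_stepZero q hB₀ne hqB₀.le hstep hd₀ hd₀deg
  -- the clause is excluded by non-terminality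
  have hwFlag : (wFlag q B hpar 1).toNat = B₀.order.toNat := by
    show (wOrder (weights 1) B₀).toNat = _
    rw [weights_one_eq, wOrder_eq]; rfl
  have hqo : q < B₀.order.toNat := by
    have hfin := MvPowerSeries.ne_zero_iff_order_finite.mp hB₀ne
    rw [← hfin] at hqB₀; exact_mod_cast hqB₀
  have hnotClause : ¬ (0 < d₀ 1 ∧ d₀ 1 < q ∧ q ∣ B₀.order.toNat) := by
    rintro ⟨-, hlt, hdvd⟩
    apply hnt
    rcases Nat.eq_zero_or_pos (dRes C {0}) with h0 | hpos
    · exact termSub_of_dRes_eq_zero {0} hC0 hCclean h0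
    · obtain ⟨j, hj⟩ := hdvd
      have hj2 : 2 ≤ j := by
        by_contra hj1
        interval_cases j <;> simp_all
      refine termSub_of_dRes_lt hC0 hCclean (m := j - 1) (by omega) ?_ hpos (lt_of_le_of_lt hres hlt)
      rw [ordAlong_zero_stepZero q hB₀ne hqB₀.le hstep, hj, Nat.mul_sub, mul_one]
  have hdFlag : dFlag q B hpar 1 = d₀ 1 := by
    unfold dFlag
    rw [hdcurv, ENat.toNat_coe, hwFlag, if_neg hnotClause]
  rw [hdFlag, Prod.Lex.toLex_lt_toLex]
  rcases hres.lt_or_eq with hlt | heq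
  · exact Or.inl hlt
  · exact Or.inr ⟨heq, Prod.Lex.toLex_lt_toLex.mpr (Or.inl zero_lt_one)⟩

end PurePowerFlag

end Summit.ResolutionOfSingularities.ResolutionOfSingularities.Theorems
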